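import Literature.Probability.FitznerVanDerHofstad2017.BlockSummationMajorant
import Literature.Barriers.CriticalPhenomena.LaceExpansionNobleCoefficients
import HarnessLib

/-!
# [FvdH17] Prop. 5.5 (5.34) → the real per-`N` bounds `hN` of `NobleNSums` (X2-sum glue)

R. Fitzner and R. van der Hofstad, *Mean-field behavior for nearest-neighbor percolation in `d > 10`*,
Electron. J. Probab. **22** (2017) no. 43; arXiv:1506.07977v2 — Remark 2.3 "Matrix-valued bounds" (pp. 12–13),
§5.1 "Elements of the bounds" (p. 49), Prop. 5.5 (5.34) (p. 53), §5.4 "Summary of the bounds" (p. 56).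

## What this module is

Pure bookkeeping between two typed shapes of the tree, kernel-checked, nothing cited as a fact, no number produced:
* the OUTPUT shape of the `N ≥ 2` chain assemblies (`NobleBoundsNAssembly*`:
  `∑' x, Ξ^{(n+1)}(x) ≤ v ᵥ* P ^ n ᵥ* Q ⬝ᵥ y` in `[0, ∞]`, over any finite class type — `Fin 3`, or `Fin 3 ⊕ Unit`
  with block vectors / matrices `Sum.elim … 0`, `Matrix.fromBlocks …`);
* the INPUT shape `hN : ∀ N, 4 ≤ N → Summable (Ξ N) ∧ ∑' x, Ξ N x ≤ u ⬝ᵥ ((B ^ (N - 1) * A) *ᵥ w)` of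
  `NobleNSums.NSumLE_rows_of_bounds` (real majorant matrices, `Ξ N = nobleXiN d p N = toReal ∘ Ξ^{(N)}`).
Provided: `vecMul_pow_vecMul_dotProduct` (orientation: `v ᵥ* P^M ᵥ* Q ⬝ᵥ y = v ⬝ᵥ ((P^M * Q) *ᵥ y)`),
`summable_toReal_and_tsum_le_of_chain_majorants` (the majorant bridge `BlockSummationMajorant` in the chain
orientation, right piece absent), entrywise majorants / non-negativity of block data (`sumElim_le_ofReal_sumElim`,
`fromBlocks_le_ofReal_fromBlocks`, `sumElim_nonneg`, `fromBlocks_nonneg`), and on the percolation side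
`nobleXiN_summable_and_tsum_le_of_chain` (one `N = n + 1`) and `nobleXiN_hN_of_chain` (literally the `hN` of
`NSumLE_rows_of_bounds` from chain bounds at every `n ≥ 3`). ADDITIVE module; `d`-generic.
-/

noncomputable section

open scoped BigOperators ENNReal Matrix

namespace Literature.Probability.FitznerVanDerHofstad2017.BlockSummation

variable {m l : Type*}

section Orientation

variable [Fintype m] [DecidableEq m]

/-- Orientation of the chain: `v ᵥ* P^M ᵥ* Q ⬝ᵥ y = v ⬝ᵥ ((P^M * Q) *ᵥ y)`. [folklore] -/
theorem vecMul_pow_vecMul_dotProduct {R : Type*} [Semiring R] (v : m → R) (P Q : Matrix m m R) (y : m → R)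
    (M : ℕ) : v ᵥ* P ^ M ᵥ* Q ⬝ᵥ y = v ⬝ᵥ ((P ^ M * Q) *ᵥ y) := by
  rw [Matrix.vecMul_vecMul, Matrix.dotProduct_mulVec]

/-- **Majorant bridge in the chain orientation.** If `Σ_x Ξ(x) ≤ v ᵥ* P^M ᵥ* Q ⬝ᵥ y` in `[0, ∞]` and `v ≤ uℝ`,
`P ≤ Bℝ`, `Q ≤ Aℝ`, `y ≤ wℝ` entrywise (real data with non-negative entries, compared via `ENNReal.ofReal`), then
`x ↦ (Ξ x).toReal` is summable and `Σ_x (Ξ x).toReal ≤ uℝ ⬝ᵥ ((Bℝ^M * Aℝ) *ᵥ wℝ)`.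
[cite: FitznerVanDerHofstad2017, Remark 2.3 (arXiv:1506.07977v2 pp. 12–13); §5.1 "Elements of the bounds" (p. 49); Prop. 5.5 (5.34) (p. 53); §5.4 (p. 56)] -/
theorem summable_toReal_and_tsum_le_of_chain_majorants {α : Type*} {Ξ : α → ℝ≥0∞} {v y : m → ℝ≥0∞}
    {P Q : Matrix m m ℝ≥0∞} {uR wR : m → ℝ} {BR AR : Matrix m m ℝ}
    (hu0 : ∀ a, 0 ≤ uR a) (hw0 : ∀ b, 0 ≤ wR b) (hB0 : ∀ a b, 0 ≤ BR a b) (hA0 : ∀ a b, 0 ≤ AR a b)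
    (hu : ∀ a, v a ≤ ENNReal.ofReal (uR a)) (hw : ∀ b, y b ≤ ENNReal.ofReal (wR b))
    (hB : ∀ a b, P a b ≤ ENNReal.ofReal (BR a b)) (hA : ∀ a b, Q a b ≤ ENNReal.ofReal (AR a b)) (M : ℕ)
    (h : ∑' x, Ξ x ≤ v ᵥ* P ^ M ᵥ* Q ⬝ᵥ y) :
    Summable (fun x => (Ξ x).toReal) ∧ ∑' x, (Ξ x).toReal ≤ uR ⬝ᵥ ((BR ^ M * AR) *ᵥ wR) := by
  have h' : ∑' x, Ξ x ≤ v ⬝ᵥ ((P ^ M * Q * (0 : Matrix m m ℝ≥0∞) ^ 0) *ᵥ y) := by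
    rwa [pow_zero, Matrix.mul_one, ← vecMul_pow_vecMul_dotProduct]
  obtain ⟨hs, hle⟩ := summable_toReal_and_tsum_le_of_majorants (Bb := (0 : Matrix m m ℝ≥0∞))
    (BbR := (0 : Matrix m m ℝ)) hu0 hw0 hB0 hA0 (fun _ _ => by simp) hu hw hB hA (fun _ _ => by simp) M 0 h'
  exact ⟨hs, by simpa only [pow_zero, Matrix.mul_one] using hle⟩

/-- The same along the whole sequence: chain bounds `Σ_x Ξ_{n+1}(x) ≤ v ᵥ* P^n ᵥ* Q ⬝ᵥ y` for every `n ≥ n₀` give,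
for every `N ≥ n₀ + 1`, summability of `x ↦ (Ξ_N x).toReal` and `Σ_x (Ξ_N x).toReal ≤ uℝ ⬝ᵥ ((Bℝ^{N−1} * Aℝ) *ᵥ wℝ)`.
[cite: FitznerVanDerHofstad2017, Remark 2.3 (arXiv:1506.07977v2 pp. 12–13); Prop. 5.5 (5.34) (p. 53)] -/
theorem perN_summable_toReal_and_tsum_le_of_chain {α : Type*} {Ξ : ℕ → α → ℝ≥0∞} {v y : m → ℝ≥0∞}
    {P Q : Matrix m m ℝ≥0∞} {uR wR : m → ℝ} {BR AR : Matrix m m ℝ}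
    (hu0 : ∀ a, 0 ≤ uR a) (hw0 : ∀ b, 0 ≤ wR b) (hB0 : ∀ a b, 0 ≤ BR a b) (hA0 : ∀ a b, 0 ≤ AR a b)
    (hu : ∀ a, v a ≤ ENNReal.ofReal (uR a)) (hw : ∀ b, y b ≤ ENNReal.ofReal (wR b))
    (hB : ∀ a b, P a b ≤ ENNReal.ofReal (BR a b)) (hA : ∀ a b, Q a b ≤ ENNReal.ofReal (AR a b)) (n₀ : ℕ)
    (hchain : ∀ n, n₀ ≤ n → ∑' x, Ξ (n + 1) x ≤ v ᵥ* P ^ n ᵥ* Q ⬝ᵥ y) :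
    ∀ N, n₀ + 1 ≤ N → Summable (fun x => (Ξ N x).toReal) ∧
      ∑' x, (Ξ N x).toReal ≤ uR ⬝ᵥ ((BR ^ (N - 1) * AR) *ᵥ wR) := by
  intro N hN
  obtain ⟨n, rfl⟩ := Nat.exists_eq_add_of_le' (le_of_add_le_right hN)
  rw [Nat.add_sub_cancel]
  exact summable_toReal_and_tsum_le_of_chain_majorants hu0 hw0 hB0 hA0 hu hw hB hA n (hchain n (by omega))

end Orientation

section BlockMajorants

/-- Entrywise majorant of a block vector from majorants of its blocks. [folklore] -/
theorem sumElim_le_ofReal_sumElim {v : m → ℝ≥0∞} {v' : l → ℝ≥0∞} {vR : m → ℝ} {v'R : l → ℝ}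
    (hv : ∀ i, v i ≤ ENNReal.ofReal (vR i)) (hv' : ∀ i, v' i ≤ ENNReal.ofReal (v'R i)) :
    ∀ i, Sum.elim v v' i ≤ ENNReal.ofReal (Sum.elim vR v'R i)
  | Sum.inl i => hv i
  | Sum.inr i => hv' i

/-- Non-negativity of a block vector from its blocks. [folklore] -/
theorem sumElim_nonneg {vR : m → ℝ} {v'R : l → ℝ} (hv : ∀ i, 0 ≤ vR i) (hv' : ∀ i, 0 ≤ v'R i) :
    ∀ i, 0 ≤ Sum.elim vR v'R i
  | Sum.inl i => hv i
  | Sum.inr i => hv' i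

/-- Entrywise majorant of a block matrix from majorants of its blocks. [folklore] -/
theorem fromBlocks_le_ofReal_fromBlocks {A : Matrix m m ℝ≥0∞} {B : Matrix m l ℝ≥0∞} {C : Matrix l m ℝ≥0∞}
    {D : Matrix l l ℝ≥0∞} {AR : Matrix m m ℝ} {BR : Matrix m l ℝ} {CR : Matrix l m ℝ} {DR : Matrix l l ℝ}
    (hA : ∀ i j, A i j ≤ ENNReal.ofReal (AR i j)) (hB : ∀ i j, B i j ≤ ENNReal.ofReal (BR i j))
    (hC : ∀ i j, C i j ≤ ENNReal.ofReal (CR i j)) (hD : ∀ i j, D i j ≤ ENNReal.ofReal (DR i j)) :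
    ∀ i j, Matrix.fromBlocks A B C D i j ≤ ENNReal.ofReal (Matrix.fromBlocks AR BR CR DR i j)
  | Sum.inl i, Sum.inl j => by rw [Matrix.fromBlocks_apply₁₁, Matrix.fromBlocks_apply₁₁]; exact hA i j
  | Sum.inl i, Sum.inr j => by rw [Matrix.fromBlocks_apply₁₂, Matrix.fromBlocks_apply₁₂]; exact hB i j
  | Sum.inr i, Sum.inl j => by rw [Matrix.fromBlocks_apply₂₁, Matrix.fromBlocks_apply₂₁]; exact hC i j
  | Sum.inr i, Sum.inr j => by rw [Matrix.fromBlocks_apply₂₂, Matrix.fromBlocks_apply₂₂]; exact hD i j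

/-- Non-negativity of a block matrix from its blocks. [folklore] -/
theorem fromBlocks_nonneg {AR : Matrix m m ℝ} {BR : Matrix m l ℝ} {CR : Matrix l m ℝ} {DR : Matrix l l ℝ}
    (hA : ∀ i j, 0 ≤ AR i j) (hB : ∀ i j, 0 ≤ BR i j) (hC : ∀ i j, 0 ≤ CR i j) (hD : ∀ i j, 0 ≤ DR i j) :
    ∀ i j, 0 ≤ Matrix.fromBlocks AR BR CR DR i j
  | Sum.inl i, Sum.inl j => by rw [Matrix.fromBlocks_apply₁₁]; exact hA i j
  | Sum.inl i, Sum.inr j => by rw [Matrix.fromBlocks_apply₁₂]; exact hB i j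
  | Sum.inr i, Sum.inl j => by rw [Matrix.fromBlocks_apply₂₁]; exact hC i j
  | Sum.inr i, Sum.inr j => by rw [Matrix.fromBlocks_apply₂₂]; exact hD i j

/-- The zero block is majorised by the zero block. [folklore] -/
theorem zero_le_ofReal_zero : ∀ (i : m) (j : l), (0 : Matrix m l ℝ≥0∞) i j ≤ ENNReal.ofReal ((0 : Matrix m l ℝ) i j) :=
  fun _ _ => by simp

/-- The zero vector is majorised by the zero vector. [folklore] -/
theorem zero_le_ofReal_zero_vec : ∀ i : l, (0 : l → ℝ≥0∞) i ≤ ENNReal.ofReal ((0 : l → ℝ) i) :=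
  fun _ => by simp

end BlockMajorants

end Literature.Probability.FitznerVanDerHofstad2017.BlockSummation

/-! ## Percolation side: `Ξ N = nobleXiN d p N` -/

namespace Literature.Probability.FitznerVanDerHofstad2017

open Literature.Probability.LatticeModels Literature.Barriers.CriticalPhenomena
open Literature.Probability.FitznerVanDerHofstad2017.BlockSummation

variable {d : ℕ}

/-- **One `N = n + 1`.** From the `[0, ∞]` chain bound `Σ_x Ξ^{(n+1)}(x) ≤ v ᵥ* P^n ᵥ* Q ⬝ᵥ y` (any finite class
type) and entrywise real majorants with non-negative entries: `nobleXiN d p (n+1)` is summable and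
`Σ_x Ξ^{(n+1)}(x) ≤ uℝ ⬝ᵥ ((Bℝ^n * Aℝ) *ᵥ wℝ)` as reals.
[cite: FitznerVanDerHofstad2017, Remark 2.3 (arXiv:1506.07977v2 pp. 12–13); Prop. 5.5 (5.34) (p. 53); §5.4 (p. 56)] -/
theorem nobleXiN_summable_and_tsum_le_of_chain (p : unitInterval) {m : Type*} [Fintype m] [DecidableEq m]
    {v y : m → ℝ≥0∞} {P Q : Matrix m m ℝ≥0∞} {uR wR : m → ℝ} {BR AR : Matrix m m ℝ}
    (hu0 : ∀ a, 0 ≤ uR a) (hw0 : ∀ b, 0 ≤ wR b) (hB0 : ∀ a b, 0 ≤ BR a b) (hA0 : ∀ a b, 0 ≤ AR a b)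
    (hu : ∀ a, v a ≤ ENNReal.ofReal (uR a)) (hw : ∀ b, y b ≤ ENNReal.ofReal (wR b))
    (hB : ∀ a b, P a b ≤ ENNReal.ofReal (BR a b)) (hA : ∀ a b, Q a b ≤ ENNReal.ofReal (AR a b)) (n : ℕ)
    (h : ∑' x, nobleXiT d p (n + 1) x ≤ v ᵥ* P ^ n ᵥ* Q ⬝ᵥ y) :
    Summable (nobleXiN d p (n + 1)) ∧ ∑' x, nobleXiN d p (n + 1) x ≤ uR ⬝ᵥ ((BR ^ n * AR) *ᵥ wR) :=
  summable_toReal_and_tsum_le_of_chain_majorants hu0 hw0 hB0 hA0 hu hw hB hA n h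

/-- **Literally the `hN` of `NobleNSums.NSumLE_rows_of_bounds`.** Chain bounds at every `n ≥ 3` and real majorants
give `∀ N, 4 ≤ N → Summable (nobleXiN d p N) ∧ Σ_x nobleXiN d p N x ≤ uℝ ⬝ᵥ ((Bℝ^{N−1} * Aℝ) *ᵥ wℝ)`.
[cite: FitznerVanDerHofstad2017, Remark 2.3 (arXiv:1506.07977v2 pp. 12–13); Prop. 5.5 (5.34) (p. 53); §5.4 (p. 56)] -/
theorem nobleXiN_hN_of_chain (p : unitInterval) {m : Type*} [Fintype m] [DecidableEq m]
    {v y : m → ℝ≥0∞} {P Q : Matrix m m ℝ≥0∞} {uR wR : m → ℝ} {BR AR : Matrix m m ℝ}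
    (hu0 : ∀ a, 0 ≤ uR a) (hw0 : ∀ b, 0 ≤ wR b) (hB0 : ∀ a b, 0 ≤ BR a b) (hA0 : ∀ a b, 0 ≤ AR a b)
    (hu : ∀ a, v a ≤ ENNReal.ofReal (uR a)) (hw : ∀ b, y b ≤ ENNReal.ofReal (wR b))
    (hB : ∀ a b, P a b ≤ ENNReal.ofReal (BR a b)) (hA : ∀ a b, Q a b ≤ ENNReal.ofReal (AR a b))
    (hchain : ∀ n, 3 ≤ n → ∑' x, nobleXiT d p (n + 1) x ≤ v ᵥ* P ^ n ᵥ* Q ⬝ᵥ y) :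
    ∀ N, 4 ≤ N → Summable (nobleXiN d p N) ∧ ∑' x, nobleXiN d p N x ≤ uR ⬝ᵥ ((BR ^ (N - 1) * AR) *ᵥ wR) :=
  perN_summable_toReal_and_tsum_le_of_chain (Ξ := fun N x => nobleXiT d p N x) hu0 hw0 hB0 hA0 hu hw hB hA 3 hchain

/-- The same from chain bounds at every `n ≥ 1` (all of Prop. 5.5, `N ≥ 2`): every `N ≥ 2`.
[cite: FitznerVanDerHofstad2017, Prop. 5.5 (5.34) (arXiv:1506.07977v2 p. 53); Remark 2.3 (pp. 12–13)] -/
theorem nobleXiN_perN_of_chain (p : unitInterval) {m : Type*} [Fintype m] [DecidableEq m]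
    {v y : m → ℝ≥0∞} {P Q : Matrix m m ℝ≥0∞} {uR wR : m → ℝ} {BR AR : Matrix m m ℝ}
    (hu0 : ∀ a, 0 ≤ uR a) (hw0 : ∀ b, 0 ≤ wR b) (hB0 : ∀ a b, 0 ≤ BR a b) (hA0 : ∀ a b, 0 ≤ AR a b)
    (hu : ∀ a, v a ≤ ENNReal.ofReal (uR a)) (hw : ∀ b, y b ≤ ENNReal.ofReal (wR b))
    (hB : ∀ a b, P a b ≤ ENNReal.ofReal (BR a b)) (hA : ∀ a b, Q a b ≤ ENNReal.ofReal (AR a b))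
    (hchain : ∀ n, 1 ≤ n → ∑' x, nobleXiT d p (n + 1) x ≤ v ᵥ* P ^ n ᵥ* Q ⬝ᵥ y) :
    ∀ N, 2 ≤ N → Summable (nobleXiN d p N) ∧ ∑' x, nobleXiN d p N x ≤ uR ⬝ᵥ ((BR ^ (N - 1) * AR) *ᵥ wR) :=
  perN_summable_toReal_and_tsum_le_of_chain (Ξ := fun N x => nobleXiT d p N x) hu0 hw0 hB0 hA0 hu hw hB hA 1 hchain

end Literature.Probability.FitznerVanDerHofstad2017

end
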